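import Mathlib
import HarnessLib
import Summits.CriticalPhenomena.SAWScalingLimit.Theses.SAWDevelopingMap
import Summits.CriticalPhenomena.SAWScalingLimit.Theorems.NoFoldBound.Negative.Ring12Refutation
import Literature.Probability.RandomPlanarGeometry.HexParafermionProofs
import Literature.Barriers.CriticalPhenomena.ParafermionicHalfCauchyRiemann

/-!
# Line `winding-zero-condensation` — skeleton for the crux `InteriorFlattening` (stmt-CriticalPhenomena-8297)

Crux (FIXED, by name): `Summit.CriticalPhenomena.SAWScalingLimit.Theses.SAWDevelopingMap.InteriorFlattening`
— bulk flattening of the Duminil-Copin–Smirnov parafermionic observable `F = F(a, ·, x_c, 5/8)` of a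
simply connected hexagonal domain: `∀ ε > 0 ∃ R` such that at every vertex `v` whose Euclidean
`R`-ball of vertices lies in `Λ`, for every labelling `w₀ w₁ w₂` of its neighbours,
`‖F₀ + ωF₁ + ω²F₂‖ ≤ ε ‖F₀ + F₁ + F₂‖` (`Fᵢ = F{v,wᵢ}`, `ω = e^{2πi/3}`), uniformly in `(Λ, a)`.

IDEA (crux idea card `winding-zero-condensation`, ideator 2, triage r1: 3 × pass; the card text is
not mounted on this hub — reconstructed from its evidence notes, its Sketch decl names
`portTransform / SectorFactor / SectorTwoPoint / WindingZeroSector / WindingZeroCondensation`, the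
kit columns `r165/75, r45/75`, and the three `TRIAGE-r1-k.md` files; see
`Lines/winding-zero-condensation.md`). "Lee–Yang sector + condensation of first-arrival winding zeros."

THE CURRENCY (triage r1-3 KEY IDENTITY, re-checked here to `1e-16` by an independent exact
enumeration). For a walk `γ : a → {v, wᵢ}` the winding is `W_γ = (π/3)·t(γ)`, `t ∈ ℤ`, and the final
half-edge direction is the initial one rotated by `W_γ`; hence `e^{2iW_γ} = uᵢ²/d_a²` depends on the
PORT only, and the three modes of the crux are SPIN-SHIFTED STAR SUMS of the observable (existing
declarations): `S_σ(v) := Σᵢ F(a, {v,wᵢ}, x_c, σ)`;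
  monopole `F₀+F₁+F₂ = S_{5/8}`;  Beltrami mode `‖F₀+ω^{∓1}F₁+ω^{∓2}F₂‖ = ‖S_{-11/8}‖`;
  DCS mode `‖F₀+ω^{±1}F₁+ω^{±2}F₂‖ = ‖S_{21/8}‖ = 0` (Lemma 1, PROVED in the tree).
So (M) at `v` is ONE two-point inequality `‖S_{-11/8}(v)‖ ≤ ε ‖S_{5/8}(v)‖` for ONE positive law
`t ↦ g_v(t)` (its transform at `82.5°` per unit of `t` against `37.5°`): `stub_spinDictionary`, the
TRANSFER `C⁺ → crux`, provable now.

PAIR–TRIPLET STRUCTURE (DCS's proof of Lemma 1 as a polynomial identity; exact in the enumeration).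
With `P_v(ζ) := Σ_γ x_c^ℓ ζ^{t(γ)}` over the walks of `Λ` to the three mid-edges of `v`,
  `P_v(ζ) = (1 + x_c ζ + x_c ζ⁻¹) · A_v(ζ) + (ζ⁴ + ζ⁻⁴) · C_v(ζ)`,
`A_v` = FIRST ARRIVALS = the same sum over the walks of the punctured domain `Λ.erase v`
(`arrivalPoly`; nonnegative coefficients, supported on ONE parity of `t`, real: its zero multiset is
invariant under `r ↦ -r` and `r ↦ r̄`), `C_v` = the first-arrival law tilted by the positive loop room
`Z∘_γ` left around `v` after `γ` (both orientations of a return loop are `ζ^{±4}`: a loop through `v`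
with the entrance outside turns by `∓300°`). At `ζ₁ = e^{i37.5°}`: `(α_T, -√3)`; at `ζ₂ = e^{i82.5°}`:
`(β_T, +√3)`; at `e^{±i157.5°}`: `(0, 0)` = Lemma 1 (the disprover's O/T structure,
`κ = (α_T, 0, β_T)`). Hence (M) splits into
  * RETURN SLAVING (`stub_returnSlaving`): returns neither cancel the monopole nor feed the Beltrami
    point beyond first arrivals (numerically `C_v(ζ_k)/A_v(ζ_k) = 0.026 → 0.048`, REAL to `10⁻³`,
    equal at both points to 15 %, all ball sources to depth 2.65; `x_c⁶ = 0.0251` = one hexagon);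
  * FIRST-ARRIVAL FLATTENING `‖A_v(ζ₂)‖ ≤ ε ‖A_v(ζ₁)‖`, attacked through the ZEROS of `A_v`. With the
    two symmetries, `(‖A_v(ζ₂)‖/‖A_v(ζ₁)‖)⁴ = ∏_{r} Φ(r)` over the zero multiset, where the ORBIT
    FACTOR `Φ(r) = N(r)/D(r)`, `N(r) = ‖ζ₂-r‖‖ζ₂+r‖‖ζ₂-r̄‖‖ζ₂+r̄‖`, `D` the same with `ζ₁`
    (`orbit_two_point`, PROVED below: pure algebra of symmetric multisets). `Φ ≤ 1` exactly on the
    complement of a bow-tie around the REAL axis (`|arg r|` or `π - |arg r|` below `45°` far from the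
    unit circle, below `55.4°` on it) — a LEE–YANG-SECTOR condition; `Φ ≤ 1/2` on a core around `±i`.
    - `stub_windingZeroSector` (open, L): every zero orbit of `A_v` is non-amplifying, `N ≤ D`,
      uniformly (exact data, all ball sources, depths 1.15–2.65: `max Φ = 0.996`, attained by FAR
      zeros; the structural strings sit at `arg ζ = ±90°` (Φ ≪ 1), `±122°` and `±54–59°`, the last
      4–9° inside the sector at their moduli; simple connectivity is load-bearing: two coherent
      corridors put zeros ON the unit circle at bad angles, `noFoldBound_false_without_simplyConnected`);
    - `stub_windingZeroCondensation : CoreZeroCondensation` (HARDEST, open, XL): the number of core zeros (`N ≤ D/2`) tends to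
      infinity with the depth — the polynomial avatar of "the lattice direction of approach to a deep
      vertex delocalises": the winding law widens, `Var t ≍ log R` (Duplantier–Saleur; radial-SLE
      winding), and for a bell of variance `V` on one parity class the zeros are `±i e^{±(2n-1)/V}`
      (Jacobi triple product), `≍ V` of them in the core.

SKELETON: 4 registered stubs; `InteriorFlattening_of` composes them BY NAME through the proved
`orbit_two_point`, `firstArrivalFlattening_of`, `twoPointFlattening_of` (no `sorry` outside `stub_*`).

DISPROOF USED (cdisprove notes (a)–(i) on the item; the file itself is not mounted here):
(a) `interiorFlattening_false_without_depth` — depth enters through `stub_windingZeroCondensation`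
(`∀ m ∃ R`) and the thresholds of the sector / slaving stubs; (b) the vacuous `∀Λ∃R` order is nowhere
used: every stub keeps `∀ε ∃R ∀(Λ,a,v)`; (c) simple connectivity is a hypothesis of every lattice stub,
USED in `stub_spinDictionary` (Lemma 1 kills the `21/8` class) and in `stub_windingZeroSector` (no
interferometric far field); (f) PortEqualisation is NOT used — the port amplitudes stay unequal, only
the spin `-11/8` transform dies; (h) no repair M′/M″ needed; (i) the cw-only reformulation is subsumed
by the dictionary. Landed negative imported and respected: `Theorems/NoFoldBound/Negative/Ring12Refutation`
(12-ring, windings `±π`: the non-simply-connected interferometer excluded here by hypothesis).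
-/

noncomputable section

open scoped BigOperators Classical ComplexConjugate
open Literature.Probability.RandomPlanarGeometry.SAW Literature.Probability.LatticeModels

namespace Summit.CriticalPhenomena.SAWScalingLimit.Cruxes.InteriorFlattening.WindingZeroCondensation

/-! ## A. Objects (over existing declarations of `HexParafermion.lean` / `HexSAW.lean`) -/

/-- `x_c = 1/√(2+√2)`. -/
abbrev xc : ℝ := hexCriticalFugacity

/-- The DCS observable of the domain `Λ` with source `a` at fugacity `x_c` and SPIN `σ`, at the
mid-edge `z`: `F(a, z, x_c, σ) = Σ_{γ ⊂ Λ : a → z} e^{-iσW_γ} x_c^{ℓ(γ)}`. -/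
def obs (Λ : Finset HexVertex) (a : Sym2 HexVertex) (σ : ℝ) (z : Sym2 HexVertex) : ℂ :=
  hexParafermionicObservable Λ a xc σ z

/-- **Spin-`σ` star sum** at `v` with neighbours `w₀ w₁ w₂`: `S_σ(v) = F_σ{v,w₀} + F_σ{v,w₁} + F_σ{v,w₂}`
— the Fourier transform at `σ·60°` per winding unit of the positive winding law of ALL walks from `a`
to the star of `v`. `S_{5/8}` is the crux's monopole `ΣFᵢ`, `‖S_{-11/8}‖` its Beltrami mode,
`S_{21/8} = 0` is Lemma 1. -/
def starSum (Λ : Finset HexVertex) (a : Sym2 HexVertex) (σ : ℝ) (v w₀ w₁ w₂ : HexVertex) : ℂ :=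
  obs Λ a σ s(v, w₀) + obs Λ a σ s(v, w₁) + obs Λ a σ s(v, w₂)

/-- `v` is `R`-deep in `Λ`: the Euclidean `R`-ball of lattice vertices around `v` lies in `Λ`
(verbatim the hypothesis of the crux). -/
def Deep (Λ : Finset HexVertex) (v : HexVertex) (R : ℝ) : Prop :=
  ∀ w : HexVertex, dist (hexCenter w) (hexCenter v) ≤ R → w ∈ Λ

/-- The winding index `t(γ) = W_γ/(π/3) ∈ ℤ` of a walk between mid-edges (the winding IS a multiple
of `π/3`: `HexMidEdgeSAW.weight_eq_pwt`, `pturn`; `round` only makes the definition total). -/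
def windIndex {Λ : Finset HexVertex} {a z : Sym2 HexVertex} (γ : HexMidEdgeSAW Λ a z) : ℤ :=
  round (γ.winding / (Real.pi / 3))

/-- **The first-arrival winding polynomial** `A_v(ζ) = Σ x_c^{ℓ(γ)} ζ^{t(γ)}` (Laurent, nonnegative
coefficients), summed over the walks of the PUNCTURED domain `Λ.erase v` from `a` to the three
mid-edges of `v` — the walks of `Λ` that reach the star of `v` for the first time, from outside.
On the unit circle `A_v(e^{-iσπ/3}) = starSum (Λ.erase v) a σ v w₀ w₁ w₂`. -/
def arrivalPoly (Λ : Finset HexVertex) (a : Sym2 HexVertex) (v w₀ w₁ w₂ : HexVertex) (ζ : ℂ) : ℂ :=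
  (∑ γ : HexMidEdgeSAW (Λ.erase v) a s(v, w₀), (xc : ℂ) ^ γ.length * ζ ^ windIndex γ) +
    (∑ γ : HexMidEdgeSAW (Λ.erase v) a s(v, w₁), (xc : ℂ) ^ γ.length * ζ ^ windIndex γ) +
    (∑ γ : HexMidEdgeSAW (Λ.erase v) a s(v, w₂), (xc : ℂ) ^ γ.length * ζ ^ windIndex γ)

/-- The MONOPOLE point `ζ₁ = e^{i·5π/24}` (`37.5°` per winding unit = spin `5/8`, conjugate side). -/
def zeta1 : ℂ := Complex.exp (((5 * Real.pi / 24 : ℝ) : ℂ) * Complex.I)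

/-- The BELTRAMI point `ζ₂ = e^{i·11π/24}` (`82.5°` per winding unit = spin `-11/8`). -/
def zeta2 : ℂ := Complex.exp (((11 * Real.pi / 24 : ℝ) : ℂ) * Complex.I)

theorem norm_zeta1 : ‖zeta1‖ = 1 := Complex.norm_exp_ofReal_mul_I _

theorem norm_zeta2 : ‖zeta2‖ = 1 := Complex.norm_exp_ofReal_mul_I _

theorem zeta2_ne_zero : zeta2 ≠ 0 := Complex.exp_ne_zero _

/-- `f = c · ζ^k · ∏_{r ∈ L} (ζ - r)` on `ℂ ∖ {0}`: a factorisation of a Laurent polynomial with zero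
multiset `L` (for `c ≠ 0` the multiset of nonzero zeros, with multiplicity, is determined by `f`). -/
def IsFactorisation (f : ℂ → ℂ) (c : ℂ) (k : ℤ) (L : Multiset ℂ) : Prop :=
  ∀ ζ : ℂ, ζ ≠ 0 → f ζ = c * ζ ^ k * (L.map fun r => ζ - r).prod

/-- The zero multiset is invariant under `r ↦ -r` (one parity class of windings) and `r ↦ r̄` (real
coefficients). -/
def IsSymmetric (L : Multiset ℂ) : Prop :=
  L.map (fun r => -r) = L ∧ L.map (fun r => conj r) = L

/-- Numerator of the ORBIT FACTOR of a zero `r`: the distances from the Beltrami point to the orbit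
`{r, -r, r̄, -r̄}`. -/
def Nfac (r : ℂ) : ℝ :=
  ‖zeta2 - r‖ * ‖zeta2 + r‖ * ‖zeta2 - conj r‖ * ‖zeta2 + conj r‖

/-- Denominator of the orbit factor: the same distances from the monopole point. -/
def Dfac (r : ℂ) : ℝ :=
  ‖zeta1 - r‖ * ‖zeta1 + r‖ * ‖zeta1 - conj r‖ * ‖zeta1 + conj r‖

/-- The orbit of `r` is NON-AMPLIFYING: `Φ(r) = N/D ≤ 1` (written multiplicatively). True exactly off a
bow-tie around the real axis: representative angle `α = min(|arg r|, π - |arg r|)` at least `45°` far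
from the unit circle, at least `55.4°` on it (`(1+ρ²)² cos 2α + 4ρ² sin² α ≤ 2ρ²(cos² 37.5° + cos² 82.5°)`). -/
def OrbitGood (r : ℂ) : Prop :=
  Nfac r ≤ Dfac r

/-- The orbit of `r` is in the CORE: `Φ(r) ≤ 1/2` (a neighbourhood of `±i` between moduli ≈ `1/2`
and `2`; e.g. `Φ(±1.21 i) = 0.08`). -/
def OrbitCore (r : ℂ) : Prop :=
  Nfac r ≤ (1 / 2) * Dfac r

/-- Number of core zeros in `L`, with multiplicity. -/
def coreCount (L : Multiset ℂ) : ℕ :=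
  Multiset.card (L.filter OrbitCore)

/-! ## B. The statements of the line -/

/-- **C⁺ — two-point flattening** (the TRANSFER target, equivalent to the crux given Lemma 1):
`∀ ε ∃ R`, at every `R`-deep vertex the spin `-11/8` star sum is at most `ε` times the spin `5/8`
star sum. One inequality for ONE positive winding law per vertex; no labellings, no vectors. -/
def TwoPointFlattening : Prop :=
  ∀ ε : ℝ, 0 < ε → ∃ R : ℝ, ∀ (Λ : Finset HexVertex), hexDomainSimplyConnected Λ →
    ∀ a ∈ hexDomainBoundary Λ, ∀ v ∈ Λ, Deep Λ v R →
      ∀ w₀ w₁ w₂ : HexVertex, hexGraph.Adj v w₀ → hexGraph.Adj v w₁ → hexGraph.Adj v w₂ →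
        w₀ ≠ w₁ → w₁ ≠ w₂ → w₀ ≠ w₂ →
          ‖starSum Λ a (-11 / 8) v w₀ w₁ w₂‖ ≤ ε * ‖starSum Λ a (5 / 8) v w₀ w₁ w₂‖

/-- **First-arrival flattening**: `‖A_v(ζ₂)‖ ≤ ε ‖A_v(ζ₁)‖` at every `R(ε)`-deep vertex (DERIVED
below from the two zero stubs; not itself a stub). -/
def FirstArrivalFlattening : Prop :=
  ∀ ε : ℝ, 0 < ε → ∃ R : ℝ, ∀ (Λ : Finset HexVertex), hexDomainSimplyConnected Λ →
    ∀ a ∈ hexDomainBoundary Λ, ∀ v ∈ Λ, Deep Λ v R →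
      ∀ w₀ w₁ w₂ : HexVertex, hexGraph.Adj v w₀ → hexGraph.Adj v w₁ → hexGraph.Adj v w₂ →
        w₀ ≠ w₁ → w₁ ≠ w₂ → w₀ ≠ w₂ →
          ‖arrivalPoly Λ a v w₀ w₁ w₂ zeta2‖ ≤ ε * ‖arrivalPoly Λ a v w₀ w₁ w₂ zeta1‖

/-- **Return slaving** (returns through `v` are slaved to first arrivals): there is `η > 0` such that
`∀ ε ∃ R`, at every `R`-deep vertex (i) the returns do not cancel the monopole,
`η ‖A_v(ζ₁)‖ ≤ ‖S_{5/8}(v)‖`, and (ii) they do not feed the Beltrami point beyond first arrivals,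
`‖S_{-11/8}(v)‖ ≤ η⁻¹ ‖A_v(ζ₂)‖ + ε ‖A_v(ζ₁)‖`. Intended proof: the pair–triplet identity
`S_σ = (1 + 2x_c cos(σπ/3))·A_v(e^{-iσπ/3}) + 2cos(4σπ/3)·Ret_σ` (exact, provable now: DCS pairs and
triplets + the loop turning `∓300°`, `HV.vertex_relation_of_wnd`) with `Ret` the first-arrival law
tilted by the loop room `Z∘_γ ∈ [0, Z_max]`, `√3·Z_max < α_T` (one hexagon `x_c⁶ = 0.025`; a
SourceLoopBound-type bound), plus decorrelation of the tilt from the winding class at the two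
frequencies (no port aliasing of the loop room). `‖A_v(ζ̄)‖ = ‖A_v(ζ)‖` (real coefficients). -/
def ReturnSlaving : Prop :=
  ∃ η : ℝ, 0 < η ∧ ∀ ε : ℝ, 0 < ε → ∃ R : ℝ, ∀ (Λ : Finset HexVertex), hexDomainSimplyConnected Λ →
    ∀ a ∈ hexDomainBoundary Λ, ∀ v ∈ Λ, Deep Λ v R →
      ∀ w₀ w₁ w₂ : HexVertex, hexGraph.Adj v w₀ → hexGraph.Adj v w₁ → hexGraph.Adj v w₂ →
        w₀ ≠ w₁ → w₁ ≠ w₂ → w₀ ≠ w₂ →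
          η * ‖arrivalPoly Λ a v w₀ w₁ w₂ zeta1‖ ≤ ‖starSum Λ a (5 / 8) v w₀ w₁ w₂‖ ∧
          ‖starSum Λ a (-11 / 8) v w₀ w₁ w₂‖ ≤
            η⁻¹ * ‖arrivalPoly Λ a v w₀ w₁ w₂ zeta2‖ + ε * ‖arrivalPoly Λ a v w₀ w₁ w₂ zeta1‖

/-- **Winding zero sector** (Lee–Yang-sector type, uniform in the domain): beyond a fixed depth `R₀`,
for every simply connected `Λ`, boundary source `a`, deep vertex `v` and labelling, the first-arrival
winding polynomial admits a SYMMETRIC factorisation all of whose zero orbits are non-amplifying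
(`N ≤ D`, i.e. every zero lies outside the bow-tie around the real axis). Existence and symmetry of
the factorisation are provable now (fundamental theorem of algebra; real coefficients; one parity
class: the three inward port directions differ by `120°`); the CONTENT is the location of the zeros.
Why plausibly true: the law is a unimodal bell with super-geometric tails; its zero strings are
structural (`±90°`, `±122°`, `±55–59°`) and all observed orbits have `Φ ≤ 0.996`; zero-sector
theorems for (ratio-)log-concave coefficients (Handelman 2013 = arXiv:1009.6022, Kurtz 1992,
Katkova–Vishnyakova 2008) are the tool family — the period-3 port ripple violates literal
log-concavity, so a ripple-tolerant version is the lemma to find. Why it might fail: the `±57°` strings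
sit at `54–59°` (by source class) while the sector boundary is `≈ 50°` at their moduli and `55.4°` on the
unit circle: a string settling below it near modulus `1` kills the stub. -/
def WindingZeroSector : Prop :=
  ∃ R₀ : ℝ, ∀ (Λ : Finset HexVertex), hexDomainSimplyConnected Λ →
    ∀ a ∈ hexDomainBoundary Λ, ∀ v ∈ Λ, Deep Λ v R₀ →
      ∀ w₀ w₁ w₂ : HexVertex, hexGraph.Adj v w₀ → hexGraph.Adj v w₁ → hexGraph.Adj v w₂ →
        w₀ ≠ w₁ → w₁ ≠ w₂ → w₀ ≠ w₂ →
          ∃ (c : ℂ) (k : ℤ) (L : Multiset ℂ), IsFactorisation (arrivalPoly Λ a v w₀ w₁ w₂) c k L ∧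
            IsSymmetric L ∧ ∀ r ∈ L, OrbitGood r

/-- **Winding zero condensation** (the HARDEST stub): `∀ m ∃ R` such that at every `R`-deep vertex of
every simply connected domain, every symmetric factorisation (`c ≠ 0`) of the first-arrival winding
polynomial has at least `m` CORE zeros (`N ≤ D/2`, with multiplicity). The polynomial avatar of "the
lattice direction of approach to a deep vertex delocalises": the winding law widens without bound,
uniformly in `(Λ, a)` (`Var t ≍ log R`), and a bell of variance `V` on one parity class has its zeros on
the imaginary axis in geometric progression of ratio `e^{2/V}`, `≍ V` of them in the core. Why it might
fail: needs BOTH the width `→ ∞` (a winding-CLT-type input for critical SAW, no FKG at `n = 0`) and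
that the new zeros populate the `±i` strings rather than the `±57°` ones; exact data reach `V ≈ 4`
(one core pair at best). -/
def CoreZeroCondensation : Prop :=
  ∀ m : ℕ, ∃ R : ℝ, ∀ (Λ : Finset HexVertex), hexDomainSimplyConnected Λ →
    ∀ a ∈ hexDomainBoundary Λ, ∀ v ∈ Λ, Deep Λ v R →
      ∀ w₀ w₁ w₂ : HexVertex, hexGraph.Adj v w₀ → hexGraph.Adj v w₁ → hexGraph.Adj v w₂ →
        w₀ ≠ w₁ → w₁ ≠ w₂ → w₀ ≠ w₂ →
          ∀ (c : ℂ) (k : ℤ) (L : Multiset ℂ), c ≠ 0 →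
            IsFactorisation (arrivalPoly Λ a v w₀ w₁ w₂) c k L → IsSymmetric L → m ≤ coreCount L

/-! ## C. The registered stubs -/

/-- **stub 1 — the spin dictionary (TRANSFER `C⁺ → crux`).** Provable now, size M. For every walk
`γ : a → {v, wᵢ}` the final half-edge direction is the initial one rotated by `W_γ`
(`Literature.Probability.LatticeModels.winding` = sum of turning angles; `HexMidEdgeSAW.weight_eq_pwt`),
so `e^{2iW_γ} = uᵢ²/d_a²` with `uᵢ = unit(c(wᵢ) - c(v))`; hence
`F_{-11/8}{v,wᵢ} = (uᵢ/d_a)² F_{5/8}{v,wᵢ}` and `F_{21/8}{v,wᵢ} = (d_a/uᵢ)² F_{5/8}{v,wᵢ}`, and since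
`u₀³ = u₁³ = u₂³` the two orientation classes of labellings give
`‖F₀ + ωF₁ + ω²F₂‖ ∈ {‖S_{-11/8}‖, ‖S_{21/8}‖}`, while `Σᵢ (pᵢ - v)Fᵢ ∝ S_{21/8} = 0` by
`DuminilCopinSmirnov2012_lemma1_holds` (where simple connectivity and `a ∈ ∂Λ` enter). With
`F₀ + F₁ + F₂ = S_{5/8}` the crux follows from `TwoPointFlattening` labelling by labelling. -/
theorem stub_spinDictionary :
    TwoPointFlattening →
      Summit.CriticalPhenomena.SAWScalingLimit.Theses.SAWDevelopingMap.InteriorFlattening := by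
  sorry

/-- **stub 2 — return slaving** (see `ReturnSlaving`). Open; size M–L; line-specific risk: port
aliasing of the loop-room tilt. -/
theorem stub_returnSlaving : ReturnSlaving := by
  sorry

/-- **stub 3 — winding zero sector** (see `WindingZeroSector`). Open; size L. -/
theorem stub_windingZeroSector : WindingZeroSector := by
  sorry

/-- **stub 4 — winding zero condensation** (see `CoreZeroCondensation`). Open; size XL;
HARDEST stub. -/
theorem stub_windingZeroCondensation : CoreZeroCondensation := by
  sorry

/-! ## D. Proved reductions (no `sorry` below this line) -/

/-- Deeper is deeper. -/
theorem Deep.mono {Λ : Finset HexVertex} {v : HexVertex} {R R' : ℝ} (h : Deep Λ v R)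
    (hR : R' ≤ R) : Deep Λ v R' :=
  fun w hw => h w (hw.trans hR)

/-- The norm of a multiset product in `ℂ`. -/
theorem norm_multiset_prod (M : Multiset ℂ) : ‖M.prod‖ = (M.map fun z => ‖z‖).prod := by
  induction M using Multiset.induction_on with
  | empty => simp
  | cons a M ih => simp [ih]

/-- Norm of a factorised Laurent polynomial at a point of the unit circle. -/
theorem norm_of_isFactorisation {f : ℂ → ℂ} {c : ℂ} {k : ℤ} {L : Multiset ℂ}
    (hf : IsFactorisation f c k L) {ζ : ℂ} (hζ : ‖ζ‖ = 1) :
    ‖f ζ‖ = ‖c‖ * (L.map fun r => ‖ζ - r‖).prod := by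
  have hζ0 : ζ ≠ 0 := by
    intro h; rw [h, norm_zero] at hζ; exact zero_ne_one hζ
  rw [hf ζ hζ0, norm_mul, norm_mul, norm_zpow, hζ, one_zpow, mul_one, norm_multiset_prod,
    Multiset.map_map]
  rfl

/-- Reindexing a product along a symmetry of the multiset. -/
theorem prod_map_comp_eq {L : Multiset ℂ} {φ : ℂ → ℂ} (hφ : L.map φ = L) (g : ℂ → ℝ) :
    (L.map fun r => g (φ r)).prod = (L.map g).prod := by
  conv_rhs => rw [← hφ, Multiset.map_map]
  rfl

/-- With the two symmetries, the fourth power of `∏ ‖ζ - r‖` is the product of the orbit distances. -/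
theorem prod_pow_four_eq {L : Multiset ℂ} (hL : IsSymmetric L) (ζ : ℂ) :
    ((L.map fun r => ‖ζ - r‖).prod) ^ 4 =
      (L.map fun r => ‖ζ - r‖ * ‖ζ + r‖ * ‖ζ - conj r‖ * ‖ζ + conj r‖).prod := by
  have h1 : (L.map fun r => ‖ζ + r‖).prod = (L.map fun r => ‖ζ - r‖).prod := by
    have := prod_map_comp_eq hL.1 (fun r => ‖ζ - r‖)
    simpa [sub_neg_eq_add] using this
  have h2 : (L.map fun r => ‖ζ - conj r‖).prod = (L.map fun r => ‖ζ - r‖).prod :=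
    prod_map_comp_eq hL.2 (fun r => ‖ζ - r‖)
  have h3 : (L.map fun r => ‖ζ + conj r‖).prod = (L.map fun r => ‖ζ - r‖).prod := by
    have hcomp : L.map (fun r => -conj r) = L := by
      have : L.map (fun r => -conj r) = (L.map fun r => conj r).map fun r => -r := by
        rw [Multiset.map_map]; rfl
      rw [this, hL.2, hL.1]
    have := prod_map_comp_eq hcomp (fun r => ‖ζ - r‖)
    simpa [sub_neg_eq_add] using this
  rw [Multiset.prod_map_mul, Multiset.prod_map_mul, Multiset.prod_map_mul, h1, h2, h3]
  ring

/-- Termwise comparison of the orbit products (induction on the multiset). -/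
theorem prod_Nfac_le (L : Multiset ℂ) (hgood : ∀ r ∈ L, OrbitGood r) :
    (L.map Nfac).prod ≤ (1 / 2 : ℝ) ^ coreCount L * (L.map Dfac).prod := by
  induction L using Multiset.induction_on with
  | empty => simp [coreCount]
  | cons a L ih =>
    have ha : OrbitGood a := hgood a (Multiset.mem_cons_self a L)
    have hL : ∀ r ∈ L, OrbitGood r := fun r hr => hgood r (Multiset.mem_cons_of_mem hr)
    have ih' := ih hL
    have hN : 0 ≤ Nfac a := by unfold Nfac; positivity
    have hD : 0 ≤ Dfac a := by unfold Dfac; positivity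
    have hprodN : 0 ≤ (L.map Nfac).prod :=
      Multiset.prod_nonneg fun x hx => by
        obtain ⟨r, -, rfl⟩ := Multiset.mem_map.1 hx
        unfold Nfac; positivity
    have hprodD : 0 ≤ (L.map Dfac).prod :=
      Multiset.prod_nonneg fun x hx => by
        obtain ⟨r, -, rfl⟩ := Multiset.mem_map.1 hx
        unfold Dfac; positivity
    have hhalf : 0 ≤ (1 / 2 : ℝ) ^ coreCount L := by positivity
    rw [Multiset.map_cons, Multiset.prod_cons, Multiset.map_cons, Multiset.prod_cons]
    by_cases hc : OrbitCore a
    · have hcount : coreCount (a ::ₘ L) = coreCount L + 1 := by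
        simp [coreCount, hc]
      rw [hcount, pow_succ]
      calc Nfac a * (L.map Nfac).prod
          ≤ ((1 / 2 : ℝ) * Dfac a) * ((1 / 2 : ℝ) ^ coreCount L * (L.map Dfac).prod) :=
            mul_le_mul hc ih' hprodN (by positivity)
        _ = (1 / 2 : ℝ) ^ coreCount L * (1 / 2) * (Dfac a * (L.map Dfac).prod) := by ring
    · have hcount : coreCount (a ::ₘ L) = coreCount L := by
        simp [coreCount, hc]
      rw [hcount]
      calc Nfac a * (L.map Nfac).prod
          ≤ Dfac a * ((1 / 2 : ℝ) ^ coreCount L * (L.map Dfac).prod) :=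
            mul_le_mul ha ih' hprodN hD
        _ = (1 / 2 : ℝ) ^ coreCount L * (Dfac a * (L.map Dfac).prod) := by ring

/-- **The sector two-point lemma (PROVED; the card's `SectorTwoPoint`)**: for a symmetrically
factorised Laurent polynomial all of whose zero orbits are non-amplifying,
`‖f(ζ₂)‖⁴ ≤ (1/2)^m ‖f(ζ₁)‖⁴` for every `m ≤ #core zeros`. Pure algebra: with the symmetries
`(∏‖ζ - r‖)⁴ = ∏ N(r)` resp. `∏ D(r)`, then compare termwise. -/
theorem orbit_two_point {f : ℂ → ℂ} {c : ℂ} {k : ℤ} {L : Multiset ℂ}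
    (hf : IsFactorisation f c k L) (hL : IsSymmetric L) (hgood : ∀ r ∈ L, OrbitGood r)
    {m : ℕ} (hm : m ≤ coreCount L) :
    ‖f zeta2‖ ^ 4 ≤ (1 / 2 : ℝ) ^ m * ‖f zeta1‖ ^ 4 := by
  rw [norm_of_isFactorisation hf norm_zeta2, norm_of_isFactorisation hf norm_zeta1, mul_pow, mul_pow,
    prod_pow_four_eq hL zeta2, prod_pow_four_eq hL zeta1]
  have hN : (L.map fun r => ‖zeta2 - r‖ * ‖zeta2 + r‖ * ‖zeta2 - conj r‖ * ‖zeta2 + conj r‖).prod =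
      (L.map Nfac).prod := rfl
  have hD : (L.map fun r => ‖zeta1 - r‖ * ‖zeta1 + r‖ * ‖zeta1 - conj r‖ * ‖zeta1 + conj r‖).prod =
      (L.map Dfac).prod := rfl
  rw [hN, hD]
  have hprodD : 0 ≤ (L.map Dfac).prod :=
    Multiset.prod_nonneg fun x hx => by
      obtain ⟨r, -, rfl⟩ := Multiset.mem_map.1 hx
      unfold Dfac; positivity
  have hpow : (1 / 2 : ℝ) ^ coreCount L ≤ (1 / 2 : ℝ) ^ m :=
    pow_le_pow_of_le_one (by norm_num) (by norm_num) hm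
  have hc4 : 0 ≤ ‖c‖ ^ 4 := by positivity
  calc ‖c‖ ^ 4 * (L.map Nfac).prod
      ≤ ‖c‖ ^ 4 * ((1 / 2 : ℝ) ^ coreCount L * (L.map Dfac).prod) :=
        mul_le_mul_of_nonneg_left (prod_Nfac_le L hgood) hc4
    _ ≤ ‖c‖ ^ 4 * ((1 / 2 : ℝ) ^ m * (L.map Dfac).prod) := by
        apply mul_le_mul_of_nonneg_left _ hc4
        exact mul_le_mul_of_nonneg_right hpow hprodD
    _ = (1 / 2 : ℝ) ^ m * (‖c‖ ^ 4 * (L.map Dfac).prod) := by ring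

/-- **Zeros ⇒ first-arrival flattening**: sector + condensation feed the orbit two-point lemma. -/
theorem firstArrivalFlattening_of (h₃ : WindingZeroSector) (h₄ : CoreZeroCondensation) :
    FirstArrivalFlattening := by
  intro ε hε
  obtain ⟨R₀, hsec⟩ := h₃
  -- choose `m` with `(1/2)^m ≤ ε⁴`, so that `(1/2)^m ≤ ε^4`
  obtain ⟨m, hm⟩ : ∃ m : ℕ, (1 / 2 : ℝ) ^ m ≤ ε ^ 4 := by
    obtain ⟨m, hm⟩ := exists_pow_lt_of_lt_one (pow_pos hε 4) (by norm_num : (1 / 2 : ℝ) < 1)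
    exact ⟨m, hm.le⟩
  obtain ⟨R₁, hR₁⟩ := h₄ m
  refine ⟨max R₀ R₁, ?_⟩
  intro Λ hΛ a ha v hv hd w₀ w₁ w₂ h₀ h₁ h₂ h01 h12 h02
  obtain ⟨c, k, L, hfac, hsym, hgood⟩ :=
    hsec Λ hΛ a ha v hv (hd.mono (le_max_left _ _)) w₀ w₁ w₂ h₀ h₁ h₂ h01 h12 h02
  set A₁ := ‖arrivalPoly Λ a v w₀ w₁ w₂ zeta1‖ with hA₁_def
  set A₂ := ‖arrivalPoly Λ a v w₀ w₁ w₂ zeta2‖ with hA₂_def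
  have hA₁ : 0 ≤ A₁ := norm_nonneg _
  have hA₂ : 0 ≤ A₂ := norm_nonneg _
  by_cases hc : c = 0
  · have hz : arrivalPoly Λ a v w₀ w₁ w₂ zeta2 = 0 := by
      rw [hfac zeta2 zeta2_ne_zero, hc]; simp
    have : A₂ = 0 := by rw [hA₂_def, hz, norm_zero]
    rw [this]
    positivity
  · have hcore : m ≤ coreCount L :=
      hR₁ Λ hΛ a ha v hv (hd.mono (le_max_right _ _)) w₀ w₁ w₂ h₀ h₁ h₂ h01 h12 h02 c k L hc
        hfac hsym
    have h4 : A₂ ^ 4 ≤ (ε * A₁) ^ 4 :=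
      calc A₂ ^ 4 ≤ (1 / 2 : ℝ) ^ m * A₁ ^ 4 := orbit_two_point hfac hsym hgood hcore
        _ ≤ ε ^ 4 * A₁ ^ 4 := mul_le_mul_of_nonneg_right hm (by positivity)
        _ = (ε * A₁) ^ 4 := by ring
    exact le_of_pow_le_pow_left₀ (by norm_num) (by positivity) h4

/-- **First arrivals + return slaving ⇒ the two-point form** (ε-bookkeeping). -/
theorem twoPointFlattening_of (h₂ : ReturnSlaving) (h₃ : FirstArrivalFlattening) :
    TwoPointFlattening := by
  obtain ⟨η, hη, hRS⟩ := h₂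
  intro ε hε
  obtain ⟨R₁, hR₁⟩ := h₃ (ε * η ^ 2 / 2) (by positivity)
  obtain ⟨R₂, hR₂⟩ := hRS (ε * η / 2) (by positivity)
  refine ⟨max R₁ R₂, ?_⟩
  intro Λ hΛ a ha v hv hd w₀ w₁ w₂ h₀ h₁ h₂ h01 h12 h02
  have hA := hR₁ Λ hΛ a ha v hv (hd.mono (le_max_left _ _)) w₀ w₁ w₂ h₀ h₁ h₂ h01 h12 h02
  obtain ⟨hM, hB⟩ := hR₂ Λ hΛ a ha v hv (hd.mono (le_max_right _ _)) w₀ w₁ w₂ h₀ h₁ h₂ h01 h12 h02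
  set A₁ := ‖arrivalPoly Λ a v w₀ w₁ w₂ zeta1‖ with hA₁_def
  set A₂ := ‖arrivalPoly Λ a v w₀ w₁ w₂ zeta2‖ with hA₂_def
  set S₁ := ‖starSum Λ a (5 / 8) v w₀ w₁ w₂‖ with hS₁_def
  set S₂ := ‖starSum Λ a (-11 / 8) v w₀ w₁ w₂‖ with hS₂_def
  have hA₁ : 0 ≤ A₁ := norm_nonneg _
  have hηinv : 0 ≤ η⁻¹ := inv_nonneg.mpr hη.le
  have hη' : η ≠ 0 := hη.ne'
  calc S₂ ≤ η⁻¹ * A₂ + ε * η / 2 * A₁ := hB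
    _ ≤ η⁻¹ * (ε * η ^ 2 / 2 * A₁) + ε * η / 2 * A₁ := by
        have := mul_le_mul_of_nonneg_left hA hηinv
        linarith
    _ = ε * (η * A₁) := by
        field_simp
        ring
    _ ≤ ε * S₁ := mul_le_mul_of_nonneg_left hM hε.le

/-! ## E. Composition (kernel-checked): the four stubs close the crux BY NAME -/

/-- **`InteriorFlattening` from the four stubs.** `sorryAx` enters only through `stub_*`. -/
theorem InteriorFlattening_of
    (h₁ : TwoPointFlattening →
      Summit.CriticalPhenomena.SAWScalingLimit.Theses.SAWDevelopingMap.InteriorFlattening)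
    (h₂ : ReturnSlaving) (h₃ : WindingZeroSector) (h₄ : CoreZeroCondensation) :
    Summit.CriticalPhenomena.SAWScalingLimit.Theses.SAWDevelopingMap.InteriorFlattening :=
  h₁ (twoPointFlattening_of h₂ (firstArrivalFlattening_of h₃ h₄))

/-- **The line as it stands** (the shape the skeleton checker registers). -/
theorem InteriorFlattening_proof :
    Summit.CriticalPhenomena.SAWScalingLimit.Theses.SAWDevelopingMap.InteriorFlattening :=
  InteriorFlattening_of stub_spinDictionary stub_returnSlaving stub_windingZeroSector
    stub_windingZeroCondensation

end Summit.CriticalPhenomena.SAWScalingLimit.Cruxes.InteriorFlattening.WindingZeroCondensation
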